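import Summits.PneNP.PneNP.Theses.ChoicelessCapture
import Literature.ModelTheory.FiniteModelTheory.CPTCardProgram
import Literature.ModelTheory.FiniteModelTheory.CountingWidth

/-!
# Line `birth` — BC3 skeleton for the crux `HamNotChoiceless` (stmt-PneNP-18191)

Route `ChoicelessCapture` (route-PneNP-ChoicelessCapture), crux (rank 3)
`HamNotChoiceless = ¬ CPTCardDefinable {A : FinGraph | A.2.IsHamiltonian}`: no PTime-bounded
Blass–Gurevich–Shelah program with `Card` decides Hamiltonicity of finite graphs (an NP query
outside CPT+Card — Grohe 2008, Problem 4 and its remark; open problem in print).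

THE LINE = the route header's own TWO-LAYER PLAN for this crux ("HamNotChoiceless ⇐
HamInterpretsThreeCol (support) → ThreeColNotChoiceless (open)"), made checkable and with the
open half WIDENED from the single query 3-colourability to the whole Hell–Nešetřil family of
NP-complete template problems `H`-COLOURING (`G ↦ ∃ hom G → H`, `H` a fixed non-bipartite finite
graph), of which 3-colourability is the member `H = K₃` and — inside CPT+Card — the HARDEST member
(every `H`-colouring reduces to it by a parameter-free first-order gadget interpretation). Three
stubs, three different kinds of work:

* `stub_hamInterpretsThreeCol` (known ingredients, size L–XL) — the route's support item
  `HamInterpretsThreeCol` (stmt-PneNP-18193) VERBATIM: CPT+Card-definability of the Hamiltonian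
  class gives CPT+Card-definability of the 3-colourable class (closure of bounded BGS+Card programs
  under the quantifier-free graph interpretation 3-COL → 3-SAT → HAM with clique-arranged variable
  gadgets, Atserias–Dawar–Ochremiak 2021 Lemmas 13–14 = arXiv:1901.07825 §5.2; closure of CPT under
  first-order interpretations: Blass–Gurevich–Shelah 1999 and the interpretation-logic
  characterisation CPT ≡ PIL of Grädel–Kaiser–Pakusa–Schalthöfer, LICS 2015).
* `stub_threeColInterpretsHColouring` (known ingredients, size XL) — 3-COLOURABILITY IS THE HARDEST
  GRAPH-TEMPLATE CSP INSIDE CPT+Card: if the 3-colourable class is CPT+Card-definable then so is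
  the class `{G | ∃ hom G → H}` for EVERY finite non-bipartite template `H` (the algebraic fact that
  `K₃` pp-constructs every finite structure — its polymorphisms are essentially unary; Bulatov–
  Jeavons–Krokhin 2005, Barto–Opršal–Pinsker 2018 §3 (tree: `PPInterpretation.lean`, gadget
  replacement `nonempty_gadget_hom_iff` PROVED there) — or, elementarily, `H`-COL → CNF-SAT → 3-SAT →
  3-COL as parameter-free first-order interpretations (Lovász–Gács 1977; Dahlhaus 1983) — composed
  with the same closure of CPT+Card under interpretations). Non-bipartiteness only excludes the
  degenerate templates (edgeless / empty `H`); it is exactly the NP-complete side of the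
  Hell–Nešetřil dichotomy (1990), so under the route's capture crux no admissible `H` is spurious.
* `stub_someHColouringNotChoiceless` (the OPEN core, size XL / open problem) — SOME non-bipartite
  finite template `H` has an `H`-colouring problem that is NOT CPT+Card-definable. This is the
  research target C⁺: it is implied by the foreseen child `ThreeColNotChoiceless` (witness `H = K₃`,
  PROVED below: `someHColouringNotChoiceless_of_threeCol`) and gives it back only through stub 2,
  and it leaves the TEMPLATE FREE — the move that produced every definability lower bound we have
  (Cai–Fürer–Immerman / Tseitin templates over `ℤ₂` for FPC, preordered CFI for rank-restricted
  and super-symmetric CPT fragments: Dawar–Richerby–Rossman 2008, Pago arXiv:2302.05426): choose the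
  odd cycle `C_{2k+1}`, Kneser or other template whose sparse high-odd-girth instances are locally
  bipartite, and prove a support/orbit indistinguishability theorem for bounded BGS+Card programs
  there. WHY IT MIGHT FAIL: no lower-bound technique for FULL CPT+Card exists (only fragments), and
  under the route's crux 2 (capture) any admissible witness proves P ≠ NP.
* the SEAM (sorry-free, proved here): `threeColNotChoiceless_of_sigs` (stub 2 + stub 3 ⇒ the
  3-colourable class is not CPT+Card-definable), `hamNotChoiceless_of_sigs : Stub1-sig → Stub2-sig →
  Stub3-sig → <crux body>` (hypotheses = the stub signatures verbatim, conclusion = the crux body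
  verbatim) and `HamNotChoiceless_of : HamNotChoiceless` — THE skeleton theorem: the crux BY NAME
  from the three declared stubs (the file's only theorem headed by the crux name, as
  `ledger skeleton check` requires — rule (ii) of `#h21_check_skeleton` admits no raw `Prop`
  hypotheses; same shape as the accepted `Cruxes/PermanentNotInP/Lines/birth.lean`).

Disproof used: none exists for this crux (`ledger crux ls stmt-PneNP-18191`: no workfiles before
this one; no Disproof.lean; no crux ideas, 2026-08-17). Negatives honoured: `ledger negatives
--problem PneNP` — none concerns CPT+Card, definability or graph homomorphisms; no stub is an
instance of one. Refuter record on the crux (CRUX-ATTACK.md, rattack-stmt-PneNP-18191): the crux is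
a proved consequence of the Statement (`HamNotChoiceless_W.lean`) and refutable only by P = NP;
the model is non-degenerate (`cptCardDefinable_hasEdge`, HasEdge.lean). BC3 probes (seat folder
`bc/probe_*.lean`, importing the route file only, stub signature inlined): `stub → HamNotChoiceless`
and `stub → PneNP` by `first | exact? | simpa | aesop` FAIL for all three stubs (outputs in the
seat's NOTES.md and in `Lines/birth.md`). Planner planner-skel-stmt-PneNP-18191-0, 2026-08-17.
-/

set_option linter.dupNamespace false

noncomputable section

namespace Summit.PneNP.PneNP.Cruxes.HamNotChoiceless.Birth

open Literature.ModelTheory.FiniteModelTheory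

/-! ## The three stubs (the ONLY sorries of this file) -/

/-- STUB 1 (= route support item `HamInterpretsThreeCol`, stmt-PneNP-18193, verbatim): Hamiltonicity
interprets 3-colourability choicelessly — CPT+Card-definability of the Hamiltonian class yields
CPT+Card-definability of the 3-colourable class. [AtseriasDawarOchremiak2021, Lemmas 13–14;
arXivmath9705225; Grädel–Kaiser–Pakusa–Schalthöfer LICS 2015 (CPT ≡ PIL)] -/
theorem stub_hamInterpretsThreeCol :
    Literature.ModelTheory.FiniteModelTheory.CPTCardDefinable {A : Literature.ModelTheory.FiniteModelTheory.FinGraph | A.2.IsHamiltonian} → Literature.ModelTheory.FiniteModelTheory.CPTCardDefinable {A : Literature.ModelTheory.FiniteModelTheory.FinGraph | A.2.Colorable 3} := by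
  sorry

/-- STUB 2 (3-colourability is the hardest graph-template CSP inside CPT+Card): if the
3-colourable class is CPT+Card-definable then, for every finite NON-BIPARTITE template `H`, the
`H`-colourable class `{G | ∃ hom G → H}` is CPT+Card-definable (`K₃` pp-constructs every finite
structure: Bulatov–Jeavons–Krokhin 2005, Barto–Opršal–Pinsker 2018 §3, tree `PPInterpretation.lean`;
elementarily `H`-COL → SAT → 3-SAT → 3-COL by parameter-free first-order interpretations,
Lovász–Gács 1977, Dahlhaus 1983; closure of CPT+Card under interpretations, CPT ≡ PIL). -/
theorem stub_threeColInterpretsHColouring :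
    Literature.ModelTheory.FiniteModelTheory.CPTCardDefinable {A : Literature.ModelTheory.FiniteModelTheory.FinGraph | A.2.Colorable 3} → ∀ (m : ℕ) (H : SimpleGraph (Fin m)), ¬ H.Colorable 2 → Literature.ModelTheory.FiniteModelTheory.CPTCardDefinable {A : Literature.ModelTheory.FiniteModelTheory.FinGraph | Nonempty (A.2 →g H)} := by
  sorry

/-- STUB 3 (the open core — an NP-complete `H`-colouring outside CPT+Card): some finite
non-bipartite template `H` (Hell–Nešetřil 1990: exactly the NP-complete `H`-colouring problems)
has an `H`-colourable class that no PTime-bounded BGS+Card program decides. Template FREE; the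
instance `H = K₃` is the foreseen layer-2 child `ThreeColNotChoiceless` of the route header
(`someHColouringNotChoiceless_of_threeCol` below). [Grohe2008, Problem 4 remark;
DawarRicherbyRossman2008; arXiv:2302.05426; AtseriasDawarOchremiak2021, Lemma 13 (its FPC shadow)] -/
theorem stub_someHColouringNotChoiceless :
    ∃ (m : ℕ) (H : SimpleGraph (Fin m)), ¬ H.Colorable 2 ∧ ¬ Literature.ModelTheory.FiniteModelTheory.CPTCardDefinable {A : Literature.ModelTheory.FiniteModelTheory.FinGraph | Nonempty (A.2 →g H)} := by
  sorry

/-! ## Sanity (sorry-free): stub 3 is implied by the foreseen child `ThreeColNotChoiceless` -/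

/-- `K₃ = ⊤` on `Fin 3` is not bipartite (a 2-colouring of `K₃` would be an injection
`Fin 3 → Fin 2`). [folklore] -/
theorem not_colorable_two_top_fin_three : ¬ (⊤ : SimpleGraph (Fin 3)).Colorable 2 := by
  rintro ⟨C⟩
  have h := Fintype.card_le_of_injective _ (SimpleGraph.Hom.injective_of_top_hom C)
  simp at h

/-- 3-colourability IS `K₃`-colourability (Mathlib: a colouring is a homomorphism to `⊤`), as
classes of finite graphs. [folklore] -/
theorem hColouringClass_top_fin_three :
    {A : FinGraph | Nonempty (A.2 →g (⊤ : SimpleGraph (Fin 3)))} = {A : FinGraph | A.2.Colorable 3} :=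
  rfl

/-- The foreseen layer-2 child `ThreeColNotChoiceless` (`¬ CPTCardDefinable {A | A.2.Colorable 3}`)
implies stub 3, with the witness `H = K₃`: stub 3 is the WEAKER, template-free research target.
[folklore] -/
theorem someHColouringNotChoiceless_of_threeCol
    (h : ¬ CPTCardDefinable {A : FinGraph | A.2.Colorable 3}) :
    ∃ (m : ℕ) (H : SimpleGraph (Fin m)), ¬ H.Colorable 2 ∧
      ¬ CPTCardDefinable {A : FinGraph | Nonempty (A.2 →g H)} :=
  ⟨3, ⊤, not_colorable_two_top_fin_three, by rw [hColouringClass_top_fin_three]; exact h⟩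

/-! ## The composition (sorry-free) and the skeleton theorem -/

/-- SEAM, first half: stubs 2 and 3 give the foreseen child — the 3-colourable class is not
CPT+Card-definable (if it were, stub 2 would make every non-bipartite `H`-colouring definable,
against the witness of stub 3). [folklore] -/
theorem threeColNotChoiceless_of_sigs
    (h₂ : CPTCardDefinable {A : FinGraph | A.2.Colorable 3} →
      ∀ (m : ℕ) (H : SimpleGraph (Fin m)), ¬ H.Colorable 2 →
        CPTCardDefinable {A : FinGraph | Nonempty (A.2 →g H)})
    (h₃ : ∃ (m : ℕ) (H : SimpleGraph (Fin m)), ¬ H.Colorable 2 ∧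
      ¬ CPTCardDefinable {A : FinGraph | Nonempty (A.2 →g H)}) :
    ¬ CPTCardDefinable {A : FinGraph | A.2.Colorable 3} := by
  intro h3
  obtain ⟨m, H, hH, hnd⟩ := h₃
  exact hnd (h₂ h3 m H hH)

/-- SEAM: the three stub SIGNATURES (verbatim) give the crux BODY (verbatim). This is the file's
mathematical composition `Stub1-sig → Stub2-sig → Stub3-sig → ¬ CPTCardDefinable {Hamiltonian}`;
the by-name skeleton theorem below feeds it the declared stubs. [folklore] -/
theorem hamNotChoiceless_of_sigs
    (h₁ : CPTCardDefinable {A : FinGraph | A.2.IsHamiltonian} →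
      CPTCardDefinable {A : FinGraph | A.2.Colorable 3})
    (h₂ : CPTCardDefinable {A : FinGraph | A.2.Colorable 3} →
      ∀ (m : ℕ) (H : SimpleGraph (Fin m)), ¬ H.Colorable 2 →
        CPTCardDefinable {A : FinGraph | Nonempty (A.2 →g H)})
    (h₃ : ∃ (m : ℕ) (H : SimpleGraph (Fin m)), ¬ H.Colorable 2 ∧
      ¬ CPTCardDefinable {A : FinGraph | Nonempty (A.2 →g H)}) :
    ¬ CPTCardDefinable {A : FinGraph | A.2.IsHamiltonian} :=
  fun hHam => threeColNotChoiceless_of_sigs h₂ h₃ (h₁ hHam)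

/-- THE SKELETON THEOREM: the crux `HamNotChoiceless` BY NAME from the three declared stubs (the
only theorem of this file whose head is the crux name, which is what `ledger skeleton check` keys
on; it is `closed = false` until the stubs land). -/
theorem HamNotChoiceless_of : Summit.PneNP.PneNP.Theses.ChoicelessCapture.HamNotChoiceless :=
  hamNotChoiceless_of_sigs stub_hamInterpretsThreeCol stub_threeColInterpretsHColouring
    stub_someHColouringNotChoiceless

end Summit.PneNP.PneNP.Cruxes.HamNotChoiceless.Birth

end
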